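import Summits.QuantumFields.YangMills.Theorems.BalabanUVNodesN08AlphaEq324RowAC
import Summits.QuantumFields.YangMills.Theorems.BalabanUVNodesN08SlotOfRecordFromAlphaAC

/-!
# Route «BalabanUVNodes», Track-A DAG node N08 = [Balaban1985UV3] Thm 1 p. 257 ∕ Thm 2 p. 272 — THE (α)-SCHEMA CURRENCY MISMATCH #3 ON THE ROAD OF RECORD,
# part 2 of 2: from the range-honest core (α)-AC clause WITH THE [B1] (3.24) ROW IN ITS PRINTED OUTPUT-SANDWICH SHAPE AT AN ARBITRARY CUMULANT LETTER
# (`…N08AlphaEq324RowAC.RunAlphaEq324CoreLTAtAC`) to the nine residual step leaves at the AC pieces, THEOREM 2 for the AC tower, the END bundle modulo B25,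
# and N08's SLOT OF RECORD `Node00.PrintedUV3V N L` — dag-n08-w1 g3's road (R4‴) (`…N08SlotOfRecordFromAlphaAC`, p605761) re-entered one (α)-currency lower

Cell `pub-ymgap`, seat `pub-ymgap-dag-n08-w4` gen 3 (CLAIM-1∕INTENT-1 INBOX l.28989; DECL-DELTA: §4 of the INTENT moved to this second file to respect the
400-line limit).  `bears_on: R4∕N08`; filed `--supports stmt-QuantumFields-20542` (K1⁷, helper).  THEOREMS ONLY (def-free), sorry-free, standard axioms; the lane's
`Summits/QuantumFields/Balaban3D/Proofs/*AC` modules and p605761 consumed BY NAME and untouched.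

WHAT THIS FILE PROVES (every proof = the corresponding proof of `Balaban3D.Proofs.Thm2AC` ∕ p605761 with the two cumulant leaves C3∕C4 supplied from the ONE
printed `Eq324` row at the letter `c k` by part 1's `cumulant58∕cumulantLower_piecesAC_of_eq324_at`, and the G3D-07∕08 binders read on the run's steps only):
* §1 `bound25_vac_coreLTAtAC`, `bound25_act_coreLTAtAC` ((25) at the chart centre ∕ for the activities on the `≤`-family); ★ `stepResidualsAC_of_coreLTAtAC`
  (`Thm2AC.StepResidualsAC 𝔠.lane X 𝔖 k`, all nine leaves incl. C10); ★ `ineq41_47_of_coreLTAtAC` — BAŁABAN CMP 102 THEOREM 2 ((41) ∧ (47), every `k ≤ K`) FOR THE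
  AC TOWER from the edition (`Thm2AC.ineq41_47_of_residualsAC`); `bound46_towerOfAC_of_coreLTAtAC` (row B15 in `AnalyticLeaves` shape, `Bound46AC.abs_pint_le_stdAC`
  fed with the range-honest `Λc∕N45`); ★★ `nonempty_analyticLeaves_towerOfAC_of_coreLTAtAC_of_lf` (the END theorem's analytic bundle at `towerOfAC`, modulo the
  displayed large-field row `hlf` = B25 read at the AC tower, exactly p605761 §2's hypothesis).
* §2 ★★★ `printedUV3G_at_record_of_coreLTAtAC_of_lf_of_window`, `printedUV3V_at_slotOfRecord_of_coreLTAtAC_of_lf_of_window`, `…_of_consts`,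
  `printedUV3V'_at_record_of_coreLTAtAC_of_lf_of_consts`, and the A6 form `printedUV3V_at_slotOfRecord_of_coreLTAtAC_of_lf_of_consts'` along p605761's∕file 9's
  inhabitant `exists_externalInputsAC_ofPrint`: **`Node00.PrintedUV3V N L` ⟸ (on `Family L (eps0Of γ₀)`) the (α)-AC rows with the (3.24) row in print's output-sandwich
  currency at ANY cumulant letter `c S k` (e.g. the FREE Gaussian moment-cumulants a [BenfattoEtAl1978]∕class supplier delivers, plugged through gen 2's
  `…RowCumLetterModel.h324RowAt_freeLetter_of_map`) over the range-honest bundle ∧ B25-at-the-AC-tower ∧ `b₀p₀^{p₀}e^{1−p₀} ≤ εbg`** — p605761's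
  `printedUV3G_of_analyticLeaves_towerAC3_of_window` BY NAME on §1's bundle.  By part 1's `coreLTAtAC_cum_of_runAlphaAC` these ENDs contain p605761's (their antecedent
  is weaker: `RunAlphaAC 𝔄 → RunAlphaEq324CoreLTAtAC (restrictLTAC 𝔄) (𝔖 ·).cum`).
LOCATED READING (R-AC-324) (count-neutral; owners — plan, dag-lead, the Balaban3D custodian, the n08-b∕-c∕-d class road — decide): on (R4‴)'s road the (3.24) row may be
read in print's currency at any letter, so a sandwich supplier for B10's step block (the class Basic Lemma to come, instantiated per gen 2's CONSUMER SPEC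
`HOME/pub-ymgap-dag-n08-w4/N08-CLASS-LEMMA-CONSUMER-SPEC.md`: `η := g_k`, `b := p(g_k)`, `t := n̄`, `σ := 1`, `κ := 6+2κ₀`, `|I| ≤ v·|T₁^{(k)}|`) lands on THE COUNT PATH.
HONEST FRAMING: count-neutral helper; the (α)-AC rows and `hlf` are HYPOTHESES whose joint satisfiability at inputs pinned to the record is N08's object gap (the k ≥ 1
cluster expansion; the IDENT of B10's step block with a class model, class II); `PrintedUV3V` NOT proved; N08 NOT discharged; counts unmoved; one finite 𝕋⁴ programme at
fixed ε, Bałaban AS PRINTED (d = 3 tori of [B10] inside the record) — R4 closes the conditional finite-𝕋⁴ rung `BalabanLadder.UV` only; the Yang–Mills mass gap (Clay) is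
NOT proved by any of this; nothing continuum ∕ ℝ⁴ ∕ OS.

References: [Balaban1985UV3] T. Bałaban, Commun. Math. Phys. 102 (1985) 255–275 — Thm 1 p. 257, Thm 2 p. 272, (25) p. 262, (41) p. 266, (46)–(47) p. 267, (55)–(62)
pp. 269–272, (65)–(71) pp. 273–274; [Balaban1985Averaging] T. Bałaban, Commun. Math. Phys. 98 (1985) 17–51 — (15) p. 19; [Balaban1982Higgs1] (3.24) p. 616;
[BenfattoEtAl1978] Lemma p. 152.
-/

noncomputable section

namespace Summit.QuantumFields.YangMills.Theorems.BalabanUVNodesN08AlphaEq324RowACEnd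

open MeasureTheory Metric
open scoped BigOperators
open Literature.MathematicalPhysics.QuantumFieldTheory.Balaban1983to89
open Literature.MathematicalPhysics.QuantumFieldTheory.Balaban1983to89.B10
open Literature.MathematicalPhysics.QuantumFieldTheory.Balaban1983to89.B10SectAGathering
open Literature.MathematicalPhysics.QuantumFieldTheory.Balaban1983to89.TreeLengthTorus (tsys)
open Literature.MathematicalPhysics.QuantumFieldTheory.Balaban1983to89.B1Sect3Statements (Eq324)
open Literature.MathematicalPhysics.QuantumFieldTheory.Balaban1983to89.Node00 (SU TFamily₃)
open Literature.MathematicalPhysics.QuantumFieldTheory.Balaban1983to89.B10RunsOfRecord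
open Literature.MathematicalPhysics.QuantumFieldTheory.Balaban1985CMP102
open Literature.MathematicalPhysics.QuantumFieldTheory.Balaban1985CMP102.Setting
open Literature.MathematicalPhysics.QuantumFieldTheory.Balaban1985CMP102.Theorems (Family)
open Literature.MathematicalPhysics.QuantumFieldTheory.Balaban1985CMP102.SectB
open Summit.QuantumFields.Balaban3D
open Summit.QuantumFields.Balaban3D.Carriers
open Summit.QuantumFields.Balaban3D.Proofs
open Summit.QuantumFields.Balaban3D.Proofs.ScalesArithmetic
open Summit.QuantumFields.Balaban3D.Proofs.Inputs
open Summit.QuantumFields.Balaban3D.Proofs.Primitives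
open Summit.QuantumFields.Balaban3D.Proofs.GroupModelLieC (lieC)
open Summit.QuantumFields.Balaban3D.Proofs.Constants (eps0Of)
open Summit.QuantumFields.Balaban3D.Proofs.UVStability3DInputs (lieChart adjAct hdet_adjAct)
open Summit.QuantumFields.Balaban3D.Proofs.FamilyLE (le_of_eps0Of thresholds_of_le)
open Summit.QuantumFields.Balaban3D.Proofs.TowerAC
open Summit.QuantumFields.Balaban3D.Proofs.SeriesAC
open Summit.QuantumFields.Balaban3D.Proofs.StandardAC
open Summit.QuantumFields.Balaban3D.Proofs.InputsAC
open Summit.QuantumFields.Balaban3D.Proofs.Bound55AC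
open Summit.QuantumFields.Balaban3D.Proofs.AlphaAC
open Summit.QuantumFields.Balaban3D.Proofs.AlphaAdaptersAC
open Summit.QuantumFields.Balaban3D.Proofs.Thm2AC
open Summit.QuantumFields.YangMills.BalabanUVNodes.N08Thm2AtRecordLevelZero
open Summit.QuantumFields.YangMills.BalabanUVNodes.N08Thm2AtRecordSeamK0
open Summit.QuantumFields.YangMills.BalabanUVNodes.N08Thm2AsPrintedAtSlotOfRecordAC
open Summit.QuantumFields.YangMills.BalabanUVNodes.N08Thm2AtRecordTransplant
open Summit.QuantumFields.YangMills.BalabanUVNodes.N08Thm2AtRecordFromAlpha (window_of_famConsts pos_of_famConsts consts_adm_of_pos)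
open Summit.QuantumFields.YangMills.BalabanUVNodes.N08SlotOfRecordFromAlphaAC
  (usesConsts_inputOfAC printedUV3G_of_analyticLeaves_towerAC3_of_window)
open Summit.QuantumFields.YangMills.Theorems.BalabanUVNodesN08AlphaEq324RowAC

variable {L : ℕ}

/-! ## §1 The residual leaves, Theorem 2 for the AC tower and the END bundle from the edition -/
section Leaves

variable {S : Scales L} {G : Type} [GaugeGroup G] [MeasurableSpace G] [HaarData G] {𝔊 : GroupModel G} {𝔠 : AlphaConsts L 𝔊.N}
  {X : ExternalInputsAC S G} {𝔖 : ∀ k, StepSeries S G ↥(lieC 𝔊) (nblkOf S 𝔠.lane.carrier k) k} {𝔄 : AlphaDataLTAC 𝔊 𝔠 X 𝔖}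
  {c : ∀ k, Hist S.P (k + 1) → GaugeField S.P (k + 1) G → ℕ → ℝ}

/-- **(25) AT THE CHART CENTRE from the edited (α)-AC step rows** (the vacuum activities `Re Ψ_X(0)` of (62); G3D-01's bound at `B = 0`).
[cite: Balaban1985UV3, (25) p.262] -/
theorem bound25_vac_coreLTAtAC {k : ℕ} {hk : k + 1 ≤ S.K} (A : StepAlphaEq324CoreLTAtAC 𝔊 𝔠 X 𝔖 𝔄 c k hk) :
    Bound25Printed ⟨(tsys 3 (nblkOf S 𝔠.lane.carrier k)).Dom, GaugeField S.P (k + 1) G, (tsys 3 (nblkOf S 𝔠.lane.carrier k)).dj,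
      fun Y _ => ((𝔖 k).Ψ Y 0).re⟩ (S.gk k) 𝔠.κ 𝔠.C25 := by
  intro Y _
  have hρ : 0 < 𝔠.ρ := (A.chart Y).1
  exact (Complex.abs_re_le_norm _).trans ((A.chart Y).2.2 0 (mem_closedBall_self (by positivity)))

/-- **CHANGING THE LETTER ON A NULL SET OF ORDERS IS FREE**: two letters that agree on `Icc 1 n̄` at every `(h, U)` of step `k` give the same step list (both rows
`hG`, `h324` read only `Σ_{n ∈ Icc 1 n̄} c k h U n ∕ n!`; gen 0's `…RowSocket.eq324_congr_cum`). [cite: Balaban1985UV3, (58) p.270 (bookkeeping)] -/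
theorem stepCoreLTAtAC_congr {c₁ c₂ : ∀ k, Hist S.P (k + 1) → GaugeField S.P (k + 1) G → ℕ → ℝ} {k : ℕ} {hk : k + 1 ≤ S.K}
    (hcc' : ∀ h U, ∀ n ∈ Finset.Icc 1 𝔠.nbar, c₂ k h U n = c₁ k h U n) (A : StepAlphaEq324CoreLTAtAC 𝔊 𝔠 X 𝔖 𝔄 c₁ k hk) :
    StepAlphaEq324CoreLTAtAC 𝔊 𝔠 X 𝔖 𝔄 c₂ k hk := by
  have hsum : ∀ h U, ∑ n ∈ Finset.Icc 1 𝔠.nbar, c₂ k h U n / (n.factorial : ℝ) = ∑ n ∈ Finset.Icc 1 𝔠.nbar, c₁ k h U n / (n.factorial : ℝ) :=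
    fun h U => Finset.sum_congr rfl fun n hn => by rw [hcc' h U n hn]
  exact
  { chart := A.chart, bound28 := A.bound28, inv26 := A.inv26, far_le := A.far_le, hPY := A.hPY, hPYZ := A.hPYZ, norm35 := A.norm35,
    logZT := A.logZT, hact := A.hact,
    hG := fun h => by simpa only [hsum h] using A.hG h,
    h324 := fun h U => BalabanUVNodesN08AlphaEq324RowSocket.eq324_congr_cum (A.h324 h U) (hcc' h U),
    h44 := A.h44, hfloor := A.hfloor, hU := A.hU, hPm := A.hPm, hPb := A.hPb, fibre49 := A.fibre49, fibre57Low := A.fibre57Low }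

variable (hle : S.g ^ 2 * S.ε₀ ≤ (min 𝔠.gamma0 1) ^ 2)
include hle

/-- **(25) FOR THE ACTIVITIES from G3D-01 + (28)** on the `≤`-family, over the edited step rows (`ChartFromBound25.bound25_real_of_chart` at the AC tower; the (28)-smallness
from `FamilyLE.thresholds_of_le`). [cite: Balaban1985UV3, (25) p.262 + (28)–(29) p.263] -/
theorem bound25_act_coreLTAtAC {k : ℕ} {hk : k + 1 ≤ S.K} (A : StepAlphaEq324CoreLTAtAC 𝔊 𝔠 X 𝔖 𝔄 c k hk) (h : Hist S.P (k + 1)) :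
    Bound25Printed ⟨(tsys 3 (nblkOf S 𝔠.lane.carrier k)).Dom, GaugeField S.P (k + 1) G, (tsys 3 (nblkOf S 𝔠.lane.carrier k)).dj,
      (𝔖 k).act h⟩ (S.gk k) 𝔠.κ 𝔠.C25 :=
  ChartFromBound25.bound25_real_of_chart (T := towerOfAC 𝔠.lane X 𝔖) (k := k) (𝔖 k).Ψ A.chart (𝔖 k).Bcfg A.bound28
    (thresholds_of_le hle k (by omega)).2.2.2.2 h

/-- ★ **THE NINE RESIDUAL STEP LEAVES AT THE AC PIECES FROM THE EDITED (α)-AC STEP ROWS on the `≤`-family** — `Thm2AC.stepResidualsAC_of_alpha` with the cumulant leaves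
C3∕C4 supplied from the ONE printed `Eq324` row at the letter `c k` (part 1's `cumulant58∕cumulantLower_piecesAC_of_eq324_at`, constant `Ca + 0 + Cc` of the record read as
`Ca + Cc`); C1∕C2 by `Bound55AC` (transported (48)–(49), exact masses), C5–C8 by the AC series leaves, C10 by `Thm2AC.oldOutside_piecesAC`; `hPYZ`∕G3D-07 read at the
range-honest `𝔄.Λc k hk`. [cite: Balaban1985UV3, (55)–(61) pp.269–271 + p.272] -/
theorem stepResidualsAC_of_coreLTAtAC {k : ℕ} (hk : k + 1 ≤ S.K) (A : StepAlphaEq324CoreLTAtAC 𝔊 𝔠 X 𝔖 𝔄 c k hk) :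
    StepResidualsAC 𝔠.lane X 𝔖 k := by
  haveI : RegularGaugeGroup G := groupModel_regularGaugeGroup 𝔊
  have hC₂ : 0 ≤ 𝔠.Ca + 0 + 𝔠.Cc := by simpa only [add_zero] using 𝔠.Cac_nonneg
  have h324' : ∀ h (U : GaugeField S.P (k + 1) G),
      Eq324 (∫ ω in (𝔖 k).box h, Real.exp ((𝔖 k).𝒱 h U ω) ∂(𝔖 k).μ) (c k h U) 𝔠.nbar (𝔠.Ca + 0 + 𝔠.Cc)
        ((L : ℝ) ^ k * S.g0sq) (3 + 𝔠.κ₀) (S.sites k) := fun h U => by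
    simpa only [add_zero] using A.h324 h U
  exact
  { bound55 := bound55_piecesAC 𝔠.lane X 𝔖 k hk
      (hint_stdAC X 𝔠.lane.carrier 𝔖 (fun _ => True) k A.hU A.hPm (𝔄.cP k) A.hPb) A.fibre49
    bound55Lower := bound55Lower_piecesAC 𝔠.lane X 𝔖 k
      (hint47_stdAC X 𝔠.lane.carrier 𝔖 (fun _ => True) k (A.hU _) (A.hPm _) (𝔄.cP k) (A.hPb _)) A.fibre57Low
    cumulant58 := cumulant58_piecesAC_of_eq324_at 𝔠.lane X 𝔖 k hk 𝔠.kappa_ge 𝔠.C25_nonneg 𝔠.one_le_r₀ 𝔠.R₁_ge hC₂ rfl rfl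
      A.hact (c k) h324' A.hG (bound25_act_coreLTAtAC hle A)
    cumulantLower := cumulantLower_piecesAC_of_eq324_at 𝔠.lane X 𝔖 k hk 𝔠.kappa_ge 𝔠.C25_nonneg 𝔠.one_le_r₀ 𝔠.R₁_ge hC₂ rfl
      A.hact (c k) h324' A.hG (bound25_act_coreLTAtAC hle A)
    repr33_60 := repr33_60_piecesAC 𝔠.lane X 𝔖 k hk 𝔠.chart (by linarith [𝔠.kappa_ge]) 𝔠.C25_nonneg 𝔠.C25_le
      𝔠.κ₀_lt_half rfl A.chart A.bound28 (thresholds_of_le hle k (by omega)).2.2.2.2 (adjAct 𝔊 (P := S.P) k) A.inv26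
      (hdet_adjAct 𝔊 k) A.far_le A.hPY
    vacuumWhole := vacuumWhole_piecesAC 𝔠.lane X 𝔖 k hk 𝔠.kappa_ge 𝔠.C25_nonneg 𝔠.one_le_r₀ 𝔠.R₁_ge rfl rfl A.chart
    decomp35_61 := decomp35_61_piecesAC 𝔠.lane X 𝔖 k hk 𝔠.chart rfl 𝔠.kappa_ge 𝔠.C63_nonneg 𝔠.C63_le 𝔠.one_le_r₀
      𝔠.κ₀_lt_half 𝔠.R₁_ge rfl A.bound28 (thresholds_of_le hle k (by omega)).2.2.2.2 (adjAct 𝔊 (P := S.P) k) (hdet_adjAct 𝔊 k)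
      (𝔄.Λc k hk) A.hPYZ
    norm35 := norm35_piecesAC 𝔠.lane X 𝔖 k 𝔠.c35_pos rfl A.norm35
    oldOutside := oldOutside_piecesAC 𝔠.lane X 𝔖 k hk 𝔠.C44_nonneg 𝔠.B₃_pos.le 𝔠.κ₁_pos rfl A.h44 A.hfloor
      (thresholds_of_le hle k (by omega)).2.2.1 }

/-- ★ **BAŁABAN CMP 102 THEOREM 2 FOR THE AC TOWER FROM THE EDITED (α)-AC CLAUSE AT AN ARBITRARY CUMULANT LETTER** on the `≤`-family `g²ε₀ ≤ (min γ₀ 1)²`: the densities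
`ρ_k = T^kρ₀` of `towerOfAC 𝔠.lane X 𝔖` satisfy (41) p. 266 and (47) p. 267 for every `k ≤ K` (`Thm2AC.ineq41_47_of_residualsAC` on §1's leaves).
[cite: Balaban1985UV3, Thm 2 p.272 + (41) p.266 + (47) p.267] -/
theorem ineq41_47_of_coreLTAtAC (R : RunAlphaEq324CoreLTAtAC 𝔊 𝔠 X 𝔖 𝔄 c) (k : ℕ) (hk : k ≤ S.K) :
    Ineq41 (towerOfAC 𝔠.lane X 𝔖) k ∧ Ineq47 (towerOfAC 𝔠.lane X 𝔖) k :=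
  ineq41_47_of_residualsAC 𝔠.lane X 𝔖 (fun j hj => stepResidualsAC_of_coreLTAtAC hle hj (R.steps j hj)) k hk

/-- **Row B15 ((46) p. 267) AT THE AC TOWER, IN `UVStability3D.AnalyticLeaves` SHAPE, FROM THE EDITED (α)-AC ROWS on the `≤`-family** — p605761's
`bound46_towerOfAC_of_alphaAC` verbatim except that `Bound46AC.abs_pint_le_stdAC` is fed with the RANGE-HONEST binders `𝔄.Λc`, `𝔄.N45` (it reads them on `k < K` only).
[cite: Balaban1985UV3, (44)–(46) p.267 + (33)–(34) p.264 + (61) p.271] -/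
theorem bound46_towerOfAC_of_coreLTAtAC (R : RunAlphaEq324CoreLTAtAC 𝔊 𝔠 X 𝔖 𝔄 c) :
    ∀ k, 1 ≤ k → k ≤ (towerOfAC 𝔠.lane X 𝔖).K → ∀ (h : (towerOfAC 𝔠.lane X 𝔖).Hist k) (U : (towerOfAC 𝔠.lane X 𝔖).Cfg k),
      |(towerOfAC 𝔠.lane X 𝔖).Pint k h U| ≤ 𝔠.lane.consts.C46 * (towerOfAC 𝔠.lane X 𝔖).M₁ ^ 3
        * (((towerOfAC 𝔠.lane X 𝔖).g (k - 1)) ^ 2 * (pFun (towerOfAC 𝔠.lane X 𝔖).b₀ (towerOfAC 𝔠.lane X 𝔖).p₀ ((towerOfAC 𝔠.lane X 𝔖).g (k - 1))) ^ 2)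
        * (towerOfAC 𝔠.lane X 𝔖).Λvol k h := by
  have h46 := Bound46AC.abs_pint_le_stdAC X 𝔠.lane.carrier 𝔖 𝔠.C44_nonneg 𝔠.B₃_pos.le 𝔠.κ₁_pos 𝔠.lane.F.M₁_pos 𝔠.lane.F.b₀_pos
    𝔠.lane.F.p₀_pos 𝔠.chart (κ := 𝔠.κ) (C25 := 𝔠.C25) (C63 := 𝔠.C63) (C45 := 𝔠.C45) (by linarith [𝔠.kappa_ge]) 𝔠.C25_nonneg 𝔠.C63_nonneg
    (lt_of_lt_of_le one_pos 𝔠.one_le_r₀) (fun k hk => (R.steps k hk).h44) (fun k hk => (R.steps k hk).hfloor)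
    (fun k hk => (thresholds_of_le hle k (by omega)).2.1) (fun k hk => (R.steps k hk).chart) (fun k hk => (R.steps k hk).bound28)
    (fun k hk => (thresholds_of_le hle k (by omega)).2.2.2.2) (fun k hk => (R.steps k hk).far_le) (fun k hk => (R.steps k hk).hPY)
    𝔄.Λc 𝔄.N45 (fun k hk => (R.steps k hk).hPYZ)
  have hL1 : (1 : ℝ) < L := by exact_mod_cast S.hL.2
  intro k hk1 hkK h U
  obtain ⟨k, rfl⟩ : ∃ k', k = k' + 1 := ⟨k - 1, by omega⟩
  have hkK' : k + 1 ≤ S.K := hkK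
  have h1 := h46 k hkK' h U
  have h2 : ((LamFin 𝔠.lane.carrier.M₁ (rcolOf S 𝔠.lane.carrier) k h).card : ℝ) ≤ (towerOfAC 𝔠.lane X 𝔖).Λvol (k + 1) h := by
    show ((LamFin 𝔠.lane.carrier.M₁ (rcolOf S 𝔠.lane.carrier) k h).card : ℝ) ≤
      min (LamVol 𝔠.lane.carrier.M₁ (rcolOf S 𝔠.lane.carrier) (k + 1) h : ℝ) (S.sites (k + 1))
    rw [LamVol_succ_eq_card_lamFin]
    refine le_min le_rfl ?_
    rw [sites_eq_card S (k + 1) (by omega)]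
    exact_mod_cast Finset.card_le_univ _
  show |(towerOfAC 𝔠.lane X 𝔖).Pint (k + 1) h U| ≤
    𝔠.lane.consts.C46 * (𝔠.lane.carrier.M₁ : ℝ) ^ 3 * ((S.gk (k + 1 - 1)) ^ 2 * (pFun 𝔠.lane.carrier.b₀ 𝔠.lane.carrier.p₀ (S.gk (k + 1 - 1))) ^ 2) *
      (towerOfAC 𝔠.lane X 𝔖).Λvol (k + 1) h
  rw [Nat.add_sub_cancel]
  have hC46 : 𝔠.lane.consts.C46 * (𝔠.lane.carrier.M₁ : ℝ) ^ 3 =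
      2 * 𝔠.C44 * (8 * (L : ℝ) ^ 2 * 𝔠.B₃ *
          (2 / (𝔠.κ₁ / 𝔠.lane.carrier.M₁) * (24 * (48 / (𝔠.κ₁ / 𝔠.lane.carrier.M₁ / 2) ^ 3 * Real.exp (𝔠.κ₁ / 𝔠.lane.carrier.M₁ / 2 / 2) /
            (1 - Real.exp (-(𝔠.κ₁ / 𝔠.lane.carrier.M₁ / 2 / 2)))) * 1))) ^ 2 * ((L : ℝ) ^ 4 / ((L : ℝ) - 1)) +
        Newborn46.Cnew46 L 𝔠.chart 𝔠.C25 𝔠.C63 𝔠.C45 𝔠.lane.carrier.b₀ 𝔠.lane.carrier.p₀ := by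
    show (2 * 𝔠.C44 * (8 * (L : ℝ) ^ 2 * 𝔠.B₃ * 𝔠.Zfull) ^ 2 * ((L : ℝ) ^ 4 / ((L : ℝ) - 1)) + 𝔠.Cnew) * ((𝔠.M₁ : ℝ)⁻¹) ^ 3 * (𝔠.M₁ : ℝ) ^ 3 = _
    rw [mul_assoc, ← mul_pow, inv_mul_cancel₀ 𝔠.M₁_pos_real.ne', one_pow, mul_one]
    rfl
  rw [hC46, ← mul_pow]
  have hgp : 0 ≤ (S.gk k * pFun 𝔠.lane.carrier.b₀ 𝔠.lane.carrier.p₀ (S.gk k)) ^ 2 := sq_nonneg _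
  have hA : 0 ≤ 2 * 𝔠.C44 * (8 * (L : ℝ) ^ 2 * 𝔠.B₃ *
          (2 / (𝔠.κ₁ / 𝔠.lane.carrier.M₁) * (24 * (48 / (𝔠.κ₁ / 𝔠.lane.carrier.M₁ / 2) ^ 3 * Real.exp (𝔠.κ₁ / 𝔠.lane.carrier.M₁ / 2 / 2) /
            (1 - Real.exp (-(𝔠.κ₁ / 𝔠.lane.carrier.M₁ / 2 / 2)))) * 1))) ^ 2 * ((L : ℝ) ^ 4 / ((L : ℝ) - 1)) +
        Newborn46.Cnew46 L 𝔠.chart 𝔠.C25 𝔠.C63 𝔠.C45 𝔠.lane.carrier.b₀ 𝔠.lane.carrier.p₀ := by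
    have : 0 < (L : ℝ) - 1 := by linarith
    have := 𝔠.C44_nonneg
    have := 𝔠.B₃_pos.le
    have hCnew : 0 ≤ Newborn46.Cnew46 L 𝔠.chart 𝔠.C25 𝔠.C63 𝔠.C45 𝔠.lane.carrier.b₀ 𝔠.lane.carrier.p₀ := 𝔠.Cnew_nonneg
    positivity
  exact h1.trans (mul_le_mul_of_nonneg_left h2 (mul_nonneg hA hgp))

/-- ★★ **THE ANALYTIC BUNDLE OF THE END THEOREM AT THE AC TOWER FROM THE EDITED (α)-AC CLAUSE on the `≤`-family, MODULO ROW B25** — p605761's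
`nonempty_analyticLeaves_towerOfAC_of_alphaAC_of_lf` with `RunAlphaAC ↦ RunAlphaEq324CoreLTAtAC … c`: (1)₀, (43)@0, the fourteen step leaves per `k < K`
(`Thm2AC.stepLeavesOfAC ∘ stepResidualsAC_of_coreLTAtAC`), B15 (`bound46_towerOfAC_of_coreLTAtAC`), B20 (← G3D-05), B21 (← G3D-01 at the chart centre), the piece equations,
and **B25 = the hypothesis `hlf`**, the text of `UVStability3D.AnalyticLeaves.lf` at the AC tower. [cite: Balaban1985UV3, pp.256–274 (the leaves) + (46) p.267 + (65) p.273 + pp.273–274] -/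
theorem nonempty_analyticLeaves_towerOfAC_of_coreLTAtAC_of_lf (R : RunAlphaEq324CoreLTAtAC 𝔊 𝔠 X 𝔖 𝔄 c)
    (hlf : ∀ k, k ≤ (towerOfAC 𝔠.lane X 𝔖).K → ∀ U : (towerOfAC 𝔠.lane X 𝔖).Cfg k,
      (towerOfAC 𝔠.lane X 𝔖).LF k U (fun h => -((towerOfAC 𝔠.lane X 𝔖).mainT k h U) + (towerOfAC 𝔠.lane X 𝔖).Zterm k h)
        ≤ Real.exp (𝔠.lane.consts.d * (towerOfAC 𝔠.lane X 𝔖).sites k)) :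
    Nonempty (UVStability3D.AnalyticLeaves 𝔠.lane.consts S (towerOfAC 𝔠.lane X 𝔖)) :=
  ⟨{ step0 := step0_towerOfAC 𝔠.lane X 𝔖
     noInt0 := noInteraction0_towerOfAC 𝔠.lane X 𝔖
     steps := fun k hk => stepLeavesOfAC k hk (stepResidualsAC_of_coreLTAtAC hle hk (R.steps k hk))
     bound46 := bound46_towerOfAC_of_coreLTAtAC hle R
     logZT_le := fun k hk => logZT_le_piecesAC 𝔠.lane X 𝔖 k 𝔠.cT_pos rfl (R.steps k hk).logZT
     PprT_le := fun k hk => pprT_le_piecesAC 𝔠.lane X 𝔖 k hk (by linarith [𝔠.kappa_ge]) 𝔠.C25_nonneg rfl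
       (bound25_vac_coreLTAtAC (R.steps k hk))
     lf := hlf
     starT_eq := fun _ _ => rfl
     logσ₀_le := fun _ _ => le_rfl
     dg_le := fun _ _ => le_rfl
     rem_eq := fun _ _ => rfl }⟩

end Leaves

/-! ## §2 The printed pair at the record's binders and THE SLOT OF RECORD from the edition — (R4‴) one (α)-currency lower -/
section Slot

variable {N : ℕ} [NeZero N] {𝔊 : GroupModel (SU N)} {𝔠 : Primitives.AlphaConsts L 𝔊.N} {εbg : ℝ}
  {X : ∀ S : Scales L, ExternalInputsAC S (SU N)}
  {𝔖 : ∀ (S : Scales L) (k : ℕ), StepSeries S (SU N) ↥(lieC 𝔊) (nblkOf S 𝔠.lane.carrier k) k}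
  {𝔄 : ∀ S : Scales L, AlphaDataLTAC 𝔊 𝔠 (X S) (𝔖 S)}
  {c : ∀ (S : Scales L) (k : ℕ), Hist S.P (k + 1) → GaugeField S.P (k + 1) (SU N) → ℕ → ℝ}

/-- ★★★ **THE PRINTED PAIR `PrintedUV3G` AT THE RECORD'S BINDERS FROM THE EDITED (α)-AC ROWS + B25-at-the-AC-tower, GIVEN THE WINDOW** (AC external inputs with the
record's minimisers above level 0; `εbg > 0`; the window at every member of `Family L (eps0Of γ₀)`; ONE `C = 𝔠.lane.consts`) — p605761's `printedUV3G_at_record_of_alphaAC_of_lf_of_window`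
with `RunAlphaAC ↦ RunAlphaEq324CoreLTAtAC … (c S)` (the (3.24) row in print's currency at any letter), through its `printedUV3G_of_analyticLeaves_towerAC3_of_window` on
§1's bundle. [cite: Balaban1985UV3, Thm 1 p.257 + Thm 2 p.272 + pp.256–274] -/
theorem printedUV3G_at_record_of_coreLTAtAC_of_lf_of_window
    (hUk : ∀ (S : Scales L) k (V : GaugeField S.P (k + 1) (SU N)), (X S).Uk k V = UkA N (fun S => (X S).av) S (k + 1) εbg V) (hpos : 0 < εbg)
    (hwin : ∀ S : Family L (eps0Of 𝔠.gamma0), eps1OfPrint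
        { eps0 := eps0Of 𝔠.gamma0, E := fun S => B10.Ek (inputOfAC 𝔠.lane (X S) (𝔖 S)).Estep S.K 0,
          b₀ := 𝔠.lane.F.b₀, p₀ := 𝔠.lane.F.p₀, εbg := εbg } S.1 0 ≤ εbg ∨ 2 < εbg)
    (R : ∀ S : Family L (eps0Of 𝔠.gamma0), RunAlphaEq324CoreLTAtAC 𝔊 𝔠 (X S.1) (𝔖 S.1) (𝔄 S.1) (c S.1))
    (hlf : ∀ S : Family L (eps0Of 𝔠.gamma0), ∀ k, k ≤ (towerOfAC 𝔠.lane (X S.1) (𝔖 S.1)).K → ∀ U : (towerOfAC 𝔠.lane (X S.1) (𝔖 S.1)).Cfg k,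
      (towerOfAC 𝔠.lane (X S.1) (𝔖 S.1)).LF k U
          (fun h => -((towerOfAC 𝔠.lane (X S.1) (𝔖 S.1)).mainT k h U) + (towerOfAC 𝔠.lane (X S.1) (𝔖 S.1)).Zterm k h)
        ≤ Real.exp (𝔠.lane.consts.d * (towerOfAC 𝔠.lane (X S.1) (𝔖 S.1)).sites k)) :
    PrintedUV3G N L (runObjects₀A N (fun S => (X S).av)
      (fun S j => (Carriers.run3 ((inputOfAC 𝔠.lane (X S) (𝔖 S)).toRunInput fun _ => True)).T j) (Backgrounds.ofAvg N L fun S => (X S).av)) :=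
  printedUV3G_of_analyticLeaves_towerAC3_of_window (fun S => inputOfAC 𝔠.lane (X S) (𝔖 S))
    { eps0 := eps0Of 𝔠.gamma0, E := fun S => B10.Ek (inputOfAC 𝔠.lane (X S) (𝔖 S)).Estep S.K 0,
      b₀ := 𝔠.lane.F.b₀, p₀ := 𝔠.lane.F.p₀, εbg := εbg }
    (consts_adm_of_pos 𝔠 hpos _) (fun _ _ => rfl) (fun S k V => hUk S k V) (fun _ => rfl) hwin 𝔠.lane.normalised
    (fun S => usesConsts_inputOfAC 𝔠.lane (X S.1) (𝔖 S.1) fun _ => True)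
    (fun S => nonempty_analyticLeaves_towerOfAC_of_coreLTAtAC_of_lf (le_of_eps0Of S.1 S.2) (R S) (hlf S))

/-- ★★★ **THE SLOT OF RECORD `Node00.PrintedUV3V N L` FROM THE EDITED (α)-AC ROWS + B25-at-the-AC-tower, GIVEN THE WINDOW — AC inputs AT PRINT'S OWN AVERAGING
(`(X S).av = avOfPrint N S`), the (3.24) row in print's output-sandwich currency at any letter, NO E6′** (file 9 §1's transfer `exists_TFamily₃_of_av_eq` supplies the version
`𝔗` of (2) along print's (15)). [cite: Balaban1985UV3, Thm 1 p.257 + Thm 2 p.272 + pp.256–274; Balaban1985Averaging, (15) p.19] -/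
theorem printedUV3V_at_slotOfRecord_of_coreLTAtAC_of_lf_of_window (hav : ∀ S, (X S).av = avOfPrint N S)
    (hUk : ∀ (S : Scales L) k (V : GaugeField S.P (k + 1) (SU N)), (X S).Uk k V = UkA N (fun S => (X S).av) S (k + 1) εbg V) (hpos : 0 < εbg)
    (hwin : ∀ S : Family L (eps0Of 𝔠.gamma0), eps1OfPrint
        { eps0 := eps0Of 𝔠.gamma0, E := fun S => B10.Ek (inputOfAC 𝔠.lane (X S) (𝔖 S)).Estep S.K 0,
          b₀ := 𝔠.lane.F.b₀, p₀ := 𝔠.lane.F.p₀, εbg := εbg } S.1 0 ≤ εbg ∨ 2 < εbg)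
    (R : ∀ S : Family L (eps0Of 𝔠.gamma0), RunAlphaEq324CoreLTAtAC 𝔊 𝔠 (X S.1) (𝔖 S.1) (𝔄 S.1) (c S.1))
    (hlf : ∀ S : Family L (eps0Of 𝔠.gamma0), ∀ k, k ≤ (towerOfAC 𝔠.lane (X S.1) (𝔖 S.1)).K → ∀ U : (towerOfAC 𝔠.lane (X S.1) (𝔖 S.1)).Cfg k,
      (towerOfAC 𝔠.lane (X S.1) (𝔖 S.1)).LF k U
          (fun h => -((towerOfAC 𝔠.lane (X S.1) (𝔖 S.1)).mainT k h U) + (towerOfAC 𝔠.lane (X S.1) (𝔖 S.1)).Zterm k h)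
        ≤ Real.exp (𝔠.lane.consts.d * (towerOfAC 𝔠.lane (X S.1) (𝔖 S.1)).sites k)) :
    Node00.PrintedUV3V N L := by
  obtain ⟨𝔗', h'⟩ := exists_TFamily₃_of_av_eq (N := N) (funext hav)
    (fun S j => (Carriers.run3 ((inputOfAC 𝔠.lane (X S) (𝔖 S)).toRunInput fun _ => True)).T j)
  have hR : runObjects₀A N (fun S => (X S).av) (fun S j => (Carriers.run3 ((inputOfAC 𝔠.lane (X S) (𝔖 S)).toRunInput fun _ => True)).T j)
      (Backgrounds.ofAvg N L fun S => (X S).av) = runObjects₀T N 𝔗' (Backgrounds.ofPrint N L) :=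
    funext fun c' => funext fun S => h' c' S
  exact ⟨𝔗', hR ▸ printedUV3G_at_record_of_coreLTAtAC_of_lf_of_window (𝔄 := 𝔄) (c := c) hUk hpos hwin R hlf⟩

/-- ★★★ **THE SLOT OF RECORD FROM THE EDITED (α)-AC ROWS + B25-at-the-AC-tower, `b₀p₀^{p₀}e^{1−p₀} ≤ εbg`** (the crude bound `ε₁(0) = g₀p(g₀) ≤ b₀p₀^{p₀}e^{1−p₀}` gives
the window at EVERY lattice approximation; no condition on `γ₀`): AC inputs at print's own averaging pinned to the record, the (3.24) row in print's currency at any letter,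
NO E6′. [cite: Balaban1985UV3, Thm 1 p.257 + Thm 2 p.272 + (7) p.257; Balaban1985Averaging, (15) p.19] -/
theorem printedUV3V_at_slotOfRecord_of_coreLTAtAC_of_lf_of_consts (hav : ∀ S, (X S).av = avOfPrint N S)
    (hUk : ∀ (S : Scales L) k (V : GaugeField S.P (k + 1) (SU N)), (X S).Uk k V = UkA N (fun S => (X S).av) S (k + 1) εbg V)
    (hε : 𝔠.lane.F.b₀ * (𝔠.lane.F.p₀ ^ 𝔠.lane.F.p₀ * Real.exp (1 - 𝔠.lane.F.p₀)) ≤ εbg)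
    (R : ∀ S : Family L (eps0Of 𝔠.gamma0), RunAlphaEq324CoreLTAtAC 𝔊 𝔠 (X S.1) (𝔖 S.1) (𝔄 S.1) (c S.1))
    (hlf : ∀ S : Family L (eps0Of 𝔠.gamma0), ∀ k, k ≤ (towerOfAC 𝔠.lane (X S.1) (𝔖 S.1)).K → ∀ U : (towerOfAC 𝔠.lane (X S.1) (𝔖 S.1)).Cfg k,
      (towerOfAC 𝔠.lane (X S.1) (𝔖 S.1)).LF k U
          (fun h => -((towerOfAC 𝔠.lane (X S.1) (𝔖 S.1)).mainT k h U) + (towerOfAC 𝔠.lane (X S.1) (𝔖 S.1)).Zterm k h)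
        ≤ Real.exp (𝔠.lane.consts.d * (towerOfAC 𝔠.lane (X S.1) (𝔖 S.1)).sites k)) :
    Node00.PrintedUV3V N L :=
  printedUV3V_at_slotOfRecord_of_coreLTAtAC_of_lf_of_window (𝔄 := 𝔄) (c := c) hav hUk (pos_of_famConsts hε)
    (fun S => window_of_famConsts hε _ S.1) R hlf

/-- ★★ **THE PRIMED SLOT `Node00.PrintedUV3V' N L` FROM THE EDITED (α)-AC ROWS + B25-at-the-AC-tower along an ADMISSIBLE AC averaging, `b₀p₀^{p₀}e^{1−p₀} ≤ εbg`**
(p605761's `printedUV3V'_at_record_of_alphaAC_of_lf_of_consts`, one (α)-currency lower). [cite: Balaban1985UV3, Thm 1 p.257 + Thm 2 p.272; Balaban1987RG1, (0.4)–(0.9) p.253] -/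
theorem printedUV3V'_at_record_of_coreLTAtAC_of_lf_of_consts (h𝔞 : Node00.AvgAdmissible₃ N fun S => (X S).av)
    (hUk : ∀ (S : Scales L) k (V : GaugeField S.P (k + 1) (SU N)), (X S).Uk k V = UkA N (fun S => (X S).av) S (k + 1) εbg V)
    (hε : 𝔠.lane.F.b₀ * (𝔠.lane.F.p₀ ^ 𝔠.lane.F.p₀ * Real.exp (1 - 𝔠.lane.F.p₀)) ≤ εbg)
    (R : ∀ S : Family L (eps0Of 𝔠.gamma0), RunAlphaEq324CoreLTAtAC 𝔊 𝔠 (X S.1) (𝔖 S.1) (𝔄 S.1) (c S.1))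
    (hlf : ∀ S : Family L (eps0Of 𝔠.gamma0), ∀ k, k ≤ (towerOfAC 𝔠.lane (X S.1) (𝔖 S.1)).K → ∀ U : (towerOfAC 𝔠.lane (X S.1) (𝔖 S.1)).Cfg k,
      (towerOfAC 𝔠.lane (X S.1) (𝔖 S.1)).LF k U
          (fun h => -((towerOfAC 𝔠.lane (X S.1) (𝔖 S.1)).mainT k h U) + (towerOfAC 𝔠.lane (X S.1) (𝔖 S.1)).Zterm k h)
        ≤ Real.exp (𝔠.lane.consts.d * (towerOfAC 𝔠.lane (X S.1) (𝔖 S.1)).sites k)) :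
    Node00.PrintedUV3V' N L :=
  ⟨fun S => (X S).av, h𝔞, fun S j => (Carriers.run3 ((inputOfAC 𝔠.lane (X S) (𝔖 S)).toRunInput fun _ => True)).T j,
    printedUV3G_at_record_of_coreLTAtAC_of_lf_of_window (𝔄 := 𝔄) (c := c) hUk (pos_of_famConsts hε) (fun S => window_of_famConsts hε _ S.1) R hlf⟩

variable (N L) in
/-- ★★★ **THE SLOT OF RECORD FROM ITS AC RESIDUALS IN PRINT'S (3.24) CURRENCY — A6 FORM ALONG p605761's∕file 9 §2's INHABITANT** (`exists_externalInputsAC_ofPrint`: AC external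
inputs AT PRINT'S AVERAGING with the record's classes and minimisers EXIST for every `εbg`): for every group `SU(N)`, constants `𝔠`, radius `εbg` with `b₀p₀^{p₀}e^{1−p₀} ≤ εbg`,
THERE ARE such inputs `X`, and for every expansion data `𝔖`, range-honest (α)-AC data `𝔄` over them and cumulant letter `c`, **the edited (α)-AC rows (the (3.24) row as the
printed sandwich `Eq324` at the letter `c`) + B25-at-the-AC-tower on the family ⇒ `Node00.PrintedUV3V N L`**.  What a supplier reads: «produce `RunAlphaEq324CoreLTAtAC … c`
for THESE print-averaging inputs at the letter your theorem speaks (the free Gaussian moment-cumulants for a [2]∕class sandwich, via gen 2's `h324RowAt_freeLetter_of_map`),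
and the large-field control at `towerOfAC`, uniformly on `Family L (eps0Of γ₀)`» — no E6′, no tilted cgf-derivative bound, no `εbg > 2`, no regime condition on `γ₀`.
[cite: Balaban1985UV3, Thm 1 p.257 + Thm 2 p.272 + pp.256–274; Balaban1985Averaging, (15) p.19; Balaban1982Higgs1, (3.24) p.616] -/
theorem printedUV3V_at_slotOfRecord_of_coreLTAtAC_of_lf_of_consts' (𝔊 : GroupModel (SU N)) (𝔠 : Primitives.AlphaConsts L 𝔊.N) (εbg : ℝ)
    (hε : 𝔠.lane.F.b₀ * (𝔠.lane.F.p₀ ^ 𝔠.lane.F.p₀ * Real.exp (1 - 𝔠.lane.F.p₀)) ≤ εbg) :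
    ∃ X : ∀ S : Scales L, ExternalInputsAC S (SU N), (∀ S, (X S).av = avOfPrint N S) ∧
      ∀ (𝔖 : ∀ (S : Scales L) (k : ℕ), StepSeries S (SU N) ↥(lieC 𝔊) (nblkOf S 𝔠.lane.carrier k) k)
        (𝔄 : ∀ S : Scales L, AlphaDataLTAC 𝔊 𝔠 (X S) (𝔖 S))
        (c : ∀ (S : Scales L) (k : ℕ), Hist S.P (k + 1) → GaugeField S.P (k + 1) (SU N) → ℕ → ℝ),
        (∀ S : Family L (eps0Of 𝔠.gamma0), RunAlphaEq324CoreLTAtAC 𝔊 𝔠 (X S.1) (𝔖 S.1) (𝔄 S.1) (c S.1)) →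
        (∀ S : Family L (eps0Of 𝔠.gamma0), ∀ k, k ≤ (towerOfAC 𝔠.lane (X S.1) (𝔖 S.1)).K → ∀ U : (towerOfAC 𝔠.lane (X S.1) (𝔖 S.1)).Cfg k,
          (towerOfAC 𝔠.lane (X S.1) (𝔖 S.1)).LF k U
              (fun h => -((towerOfAC 𝔠.lane (X S.1) (𝔖 S.1)).mainT k h U) + (towerOfAC 𝔠.lane (X S.1) (𝔖 S.1)).Zterm k h)
            ≤ Real.exp (𝔠.lane.consts.d * (towerOfAC 𝔠.lane (X S.1) (𝔖 S.1)).sites k)) →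
        Node00.PrintedUV3V N L := by
  obtain ⟨X, hav, -, hUk⟩ := exists_externalInputsAC_ofPrint N L εbg
  exact ⟨X, hav, fun 𝔖 𝔄 c R hlf => printedUV3V_at_slotOfRecord_of_coreLTAtAC_of_lf_of_consts (𝔄 := 𝔄) (c := c) hav hUk hε R hlf⟩

/-- ★ **… AND (R4‴) ITSELF IS THE χ-LETTER INSTANCE**: p605761's antecedent `RunAlphaAC` on the family gives this file's antecedent at the lane's letter `(𝔖 S ·).cum` over
`restrictLTAC` (part 1's `coreLTAtAC_cum_of_runAlphaAC`), so the slot of record from `RunAlphaAC` + B25-at-the-AC-tower is recovered as a one-line corollary — the edition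
loses nothing along (R4‴). [cite: Balaban1985UV3, Thm 1 p.257 + Thm 2 p.272 (bookkeeping)] -/
theorem printedUV3V_at_slotOfRecord_of_alphaAC_of_lf_of_consts_via_eq324 {𝔄' : ∀ S : Scales L, AlphaDataAC 𝔊 𝔠 (X S) (𝔖 S)}
    (hav : ∀ S, (X S).av = avOfPrint N S)
    (hUk : ∀ (S : Scales L) k (V : GaugeField S.P (k + 1) (SU N)), (X S).Uk k V = UkA N (fun S => (X S).av) S (k + 1) εbg V)
    (hε : 𝔠.lane.F.b₀ * (𝔠.lane.F.p₀ ^ 𝔠.lane.F.p₀ * Real.exp (1 - 𝔠.lane.F.p₀)) ≤ εbg)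
    (R : ∀ S : Family L (eps0Of 𝔠.gamma0), RunAlphaAC 𝔊 𝔠 (X S.1) (𝔖 S.1) (𝔄' S.1))
    (hlf : ∀ S : Family L (eps0Of 𝔠.gamma0), ∀ k, k ≤ (towerOfAC 𝔠.lane (X S.1) (𝔖 S.1)).K → ∀ U : (towerOfAC 𝔠.lane (X S.1) (𝔖 S.1)).Cfg k,
      (towerOfAC 𝔠.lane (X S.1) (𝔖 S.1)).LF k U
          (fun h => -((towerOfAC 𝔠.lane (X S.1) (𝔖 S.1)).mainT k h U) + (towerOfAC 𝔠.lane (X S.1) (𝔖 S.1)).Zterm k h)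
        ≤ Real.exp (𝔠.lane.consts.d * (towerOfAC 𝔠.lane (X S.1) (𝔖 S.1)).sites k)) :
    Node00.PrintedUV3V N L :=
  printedUV3V_at_slotOfRecord_of_coreLTAtAC_of_lf_of_consts (𝔄 := fun S => restrictLTAC (𝔄' S)) (c := fun S k => (𝔖 S k).cum) hav hUk hε
    (fun S => coreLTAtAC_cum_of_runAlphaAC (R S)) hlf

end Slot

end Summit.QuantumFields.YangMills.Theorems.BalabanUVNodesN08AlphaEq324RowACEnd

end
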